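import Summits.Ventures.PackingBounds.Energy.FivePointRieszEightGramDataY1
import Summits.Ventures.PackingBounds.Energy.FivePointRieszEightGramDataY2
import Summits.Ventures.PackingBounds.Energy.FivePointRieszEightGramDataY3
import Summits.Ventures.PackingBounds.Energy.FivePointRieszEightGramDataY4
import Summits.Ventures.PackingBounds.Energy.FivePointRieszEightGramDataY5
import Summits.Ventures.PackingBounds.Energy.FivePointRieszEightGramDataY6
import HarnessLib

/-!
# Integer Gram data `S·Y = L Lᵀ + E` (S and the rows of S·Y: the table (collector of 6 part modules)) of the 158 × 158 SOS block of the exact sharp three-point certificate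
# `e3pt-sharp-n3N5s8d8-none.json` (triangular bipyramid; five points on S², single SOS term, d = 8)

Framing: lottery ticket; floor = certified bounds/negative ranges. Venture `PackingBounds`, cell `pub-packcert`, energy family E3PT
(pub-packcert-energy gen 15; KERNEL-D6 data route). `yR8` = S·Y (S = `scaleR8` = lcm of denominators · 2^40), `lR8` = rounded scaled Cholesky
factor, `eR8` = S·Y − lR8·lR8ᵀ (exact; symmetric, diagonally dominant). Checked by `decide +kernel` with `GramData.checkRows` / `checkDD`
in `FivePointRieszEightGramFacts*`; generator `pub-packcert-energy/code/e3pt/g17/e3pt_lean_n3x.py`. (Rows split in independent modules for the gate's request-size limit; one collector per table.)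
-/

namespace Summit.Ventures.PackingBounds.Energy.RieszEightD8

/-- The scale `S` (`yR8 = S·Y`). -/
def scaleR8 : ℤ := 2523456273247926227465821216000966656

/-- data rows. -/
def yR8 : List (List ℤ) := [yR80, yR81, yR82, yR83, yR84, yR85, yR86, yR87, yR88, yR89, yR810, yR811, yR812, yR813, yR814, yR815, yR816, yR817, yR818, yR819, yR820, yR821, yR822, yR823, yR824, yR825, yR826, yR827, yR828, yR829, yR830, yR831, yR832, yR833, yR834, yR835, yR836, yR837, yR838, yR839, yR840, yR841, yR842, yR843, yR844, yR845, yR846, yR847, yR848, yR849, yR850, yR851, yR852, yR853, yR854, yR855, yR856, yR857, yR858, yR859, yR860, yR861, yR862, yR863, yR864, yR865, yR866, yR867, yR868, yR869, yR870, yR871, yR872, yR873, yR874, yR875, yR876, yR877, yR878, yR879, yR880, yR881, yR882, yR883, yR884, yR885, yR886, yR887, yR888, yR889, yR890, yR891, yR892, yR893, yR894, yR895, yR896, yR897, yR898, yR899, yR8100, yR8101, yR8102, yR8103, yR8104, yR8105, yR8106, yR8107, yR8108, yR8109, yR8110, yR8111, yR8112, yR8113, yR8114, yR8115, yR8116, yR8117,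 yR8118, yR8119, yR8120, yR8121, yR8122, yR8123, yR8124, yR8125, yR8126, yR8127, yR8128, yR8129, yR8130, yR8131, yR8132, yR8133, yR8134, yR8135, yR8136, yR8137, yR8138, yR8139, yR8140, yR8141, yR8142, yR8143, yR8144, yR8145, yR8146, yR8147, yR8148, yR8149, yR8150, yR8151, yR8152, yR8153, yR8154, yR8155, yR8156, yR8157]

end Summit.Ventures.PackingBounds.Energy.RieszEightD8
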